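import Summits.FinalStateConjecture.FinalStateConjecture.Theorems.StarvedNecksGapDecaySufficesStubAssembly

/-!
# Stub `stub_certificateBookkeeping` (B of line `Sketch`, crux `GapDecaySuffices`) — file 3: K10

K10 of the v5 `NeckCertificate` for the parity-relabelled decomposition `relabelEach d P` — images of
different holes' late tubes `{τ₁ < tᵢ, rᵢ < Rcᵢ(tᵢ) + 2}` under the re-gauged charts `Ψaᵢ` are
disjoint — from the synchronised single-hole clauses (one atlas K7, inner location, coverage), the
lateness / separation facts of file 2, injectivity of the flat chart on the late region, and the two
clauses of the residual `GapTubesExclusive` (file 1).  Each tube point is either OUTER (`4ρ'ᵢ(x⁰) ≤ rᵢ`: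
flat image of a late point of the analysis collar `[4ρ'ᵢ, 40ρ'ᵢ]`) or INNER (`rᵢ ≤ 4ρ'ᵢ(x⁰)`: the
`Ψgᵢ`-image of a late deep gap-tube point, `rᵢ ≤ 5ρ'ᵢ` of its own flat time, by inner location and
the deep-witness lemma); outer/outer is excluded by injectivity of `Φ` and separation of the analysis
regions, the three other combinations are the residual.  No `sorry`, standard axioms.
-/

noncomputable section

open scoped Manifold ContDiff Topology ENNReal
open Filter Set Topology Literature.Geometry.Lorentzian

namespace Summit.FinalStateConjecture.FinalStateConjecture.Theorems.GapDecaySuffices.Bookkeeping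

-- justified lint debt: the problem namespace repeats the summit name (`FinalStateConjecture.FinalStateConjecture`)
set_option linter.dupNamespace false

open Relabel (ParityDatum relabelMotion relabelChart relabelEach)

variable {𝓢 : Spacetime.{0} 4} {O : Set 𝓢.carrier} (d : FinalStateDecomposition 𝓢 O 4)
  (P : ∀ i : Fin d.N, ParityDatum (d.motion i).1)

set_option maxHeartbeats 800000 in
/-- **K10 from `GapTubesExclusive`.**  Data: profiles `ρ'ᵢ ≥ 0`, certified radii `Rcᵢ`, gap charts
`Ψgᵢ`, re-gauged charts `Ψaᵢ` of `relabelEach d P`; a hole threshold `τ₁` and flat thresholds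
`Tn ≤ T` with `τ₀ < T`, `τe ≤ T`.  Hypotheses (all radii/clocks those of `d`, which are those of
`relabelEach d P`): one atlas from flat time `Tn` (K7), inner location and coverage after hole time `τ₁`,
`|κ'ᵢ| ≤ 1/2` after `τ₁`, flat lateness `≥ T` of late tube points, separation of the analysis regions
`rᵢ ≤ 40ρ'ᵢ` after `T`, the deep-witness property after `τ₁` with threshold `τe`, injectivity of `Φ`
on the late region, and the two exclusion clauses at `τe`.  Conclusion: K10 at `τ₁`. -/
theorem k10_of_exclusive (ρ' Rc κ' W : Fin d.N → ℝ → ℝ) (τg : Fin d.N → ℝ)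
    (Ψg : ∀ i, (d.background i).domain → 𝓢.carrier)
    (Ψa : ∀ i, ((relabelEach d P).background i).domain → 𝓢.carrier) (τ₁ Tn T τe : ℝ)
    (hρ0 : ∀ i s, 0 ≤ ρ' i s) (hTn : Tn ≤ T) (hT0 : d.τ₀ < T) (hTe : τe ≤ T)
    (hK7 : ∀ i (y : E4) (hy : y ∈ ((relabelEach d P).background i).domain), Tn ≤ y 0 →
      4 * ρ' i (y 0) ≤ (d.background i).radius y →
      (d.background i).radius y ≤ Rc i ((d.background i).time y) + 2 →
      ∃ hy' : y ∈ d.flatDomain, Ψa i ⟨y, hy⟩ = d.flatChart ⟨y, hy'⟩)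
    (hinner : ∀ i (x : ((relabelEach d P).background i).domain), τ₁ < (d.background i).time x.1 →
      (d.background i).radius x.1 ≤ 4 * ρ' i (x.1 0) →
      ∃ x' : (d.background i).domain, τg i < (d.background i).time x'.1 ∧
        (d.background i).radius x'.1 < W i (x'.1 0) ∧ Ψa i x = Ψg i x' ∧
        |(d.background i).time x'.1 - (d.background i).time x.1| ≤
          κ' i ((d.background i).time x.1) * ρ' i (x.1 0) ∧
        |(d.background i).radius x'.1 - (d.background i).radius x.1| ≤
          κ' i ((d.background i).time x.1) * ρ' i (x.1 0))
    (hcov : ∀ i (x : ((relabelEach d P).background i).domain), τ₁ < (d.background i).time x.1 →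
      (d.background i).radius x.1 < Rc i ((d.background i).time x.1) + 2 →
      (d.background i).radius x.1 ≤ 40 * ρ' i (x.1 0))
    (hκ : ∀ i s, τ₁ ≤ s → |κ' i s| ≤ 1 / 2)
    (hlate : ∀ i (y : E4), τ₁ ≤ (d.background i).time y →
      (d.background i).radius y ≤ 40 * ρ' i (y 0) → T ≤ y 0)
    (hsep : ∀ (i j : Fin d.N) (y : E4), i ≠ j → T ≤ y 0 →
      (d.background i).radius y ≤ 40 * ρ' i (y 0) → 40 * ρ' j (y 0) < (d.background j).radius y)
    (hdeep : ∀ i (x x'' : E4), τ₁ ≤ (d.background i).time x →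
      (d.background i).radius x ≤ 4 * ρ' i (x 0) →
      |(d.background i).time x'' - (d.background i).time x| ≤ ρ' i (x 0) / 2 →
      |(d.background i).radius x'' - (d.background i).radius x| ≤ ρ' i (x 0) / 2 →
      τe ≤ (d.background i).time x'' ∧ τe ≤ x'' 0 ∧ (d.background i).radius x'' ≤ 5 * ρ' i (x'' 0))
    (hinj : ∀ y y' : d.flatDomain, d.τ₀ < y.1 0 → d.τ₀ < y'.1 0 →
      d.flatChart y = d.flatChart y' → y.1 = y'.1)
    (hex1 : ∀ i j : Fin d.N, i ≠ j → ∀ (x : (d.background i).domain) (x' : (d.background j).domain),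
      τe ≤ (d.background i).time x.1 → τe ≤ x.1 0 → (d.background i).radius x.1 ≤ 5 * ρ' i (x.1 0) →
      τe ≤ (d.background j).time x'.1 → τe ≤ x'.1 0 →
      (d.background j).radius x'.1 ≤ 5 * ρ' j (x'.1 0) → Ψg i x ≠ Ψg j x')
    (hex2 : ∀ i j : Fin d.N, i ≠ j → ∀ (x : (d.background i).domain) (y : d.flatDomain),
      τe ≤ (d.background i).time x.1 → τe ≤ x.1 0 → (d.background i).radius x.1 ≤ 5 * ρ' i (x.1 0) →
      τe ≤ y.1 0 → 4 * ρ' j (y.1 0) ≤ (d.background j).radius y.1 →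
      (d.background j).radius y.1 ≤ 40 * ρ' j (y.1 0) → Ψg i x ≠ d.flatChart y) :
    ∀ i j : Fin d.N, i ≠ j →
      Disjoint (Ψa i '' {x | τ₁ < ((relabelEach d P).background i).time x.1 ∧
          ((relabelEach d P).background i).radius x.1 <
            Rc i (((relabelEach d P).background i).time x.1) + 2})
        (Ψa j '' {x | τ₁ < ((relabelEach d P).background j).time x.1 ∧
          ((relabelEach d P).background j).radius x.1 <
            Rc j (((relabelEach d P).background j).time x.1) + 2}) := by
  -- the dichotomy at one late tube point
  have side : ∀ k (z : ((relabelEach d P).background k).domain), τ₁ < (d.background k).time z.1 →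
      (d.background k).radius z.1 < Rc k ((d.background k).time z.1) + 2 →
      (∃ hy' : z.1 ∈ d.flatDomain, Ψa k z = d.flatChart ⟨z.1, hy'⟩ ∧
          4 * ρ' k (z.1 0) ≤ (d.background k).radius z.1 ∧
          (d.background k).radius z.1 ≤ 40 * ρ' k (z.1 0) ∧ T ≤ z.1 0) ∨
        (∃ x'' : (d.background k).domain, Ψa k z = Ψg k x'' ∧ τe ≤ (d.background k).time x''.1 ∧
          τe ≤ x''.1 0 ∧ (d.background k).radius x''.1 ≤ 5 * ρ' k (x''.1 0)) := by
    intro k z hzt hzr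
    have hz40 := hcov k z hzt hzr
    have hzT := hlate k z.1 hzt.le hz40
    rcases le_or_gt ((d.background k).radius z.1) (4 * ρ' k (z.1 0)) with hin | hout
    · obtain ⟨x'', -, -, hΨ, hdt, hdr⟩ := hinner k z hzt hin
      have hκρ : κ' k ((d.background k).time z.1) * ρ' k (z.1 0) ≤ ρ' k (z.1 0) / 2 := by
        have h1 := (abs_le.1 (hκ k _ hzt.le)).2
        have h2 := hρ0 k (z.1 0)
        nlinarith
      obtain ⟨hte, hx0, hr5⟩ := hdeep k z.1 x''.1 hzt.le hin (hdt.trans hκρ) (hdr.trans hκρ)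
      exact Or.inr ⟨x'', hΨ, hte, hx0, hr5⟩
    · obtain ⟨hy', hΦ⟩ := hK7 k z.1 z.2 (hTn.trans hzT) hout.le hzr.le
      exact Or.inl ⟨hy', hΦ, hout.le, hz40, hzT⟩
  intro i j hij
  rw [Set.disjoint_left]
  rintro _ ⟨x, ⟨hxt, hxr⟩, rfl⟩ ⟨x', ⟨hx't, hx'r⟩, heq⟩
  simp only [Relabel.relabelEach_time, Relabel.relabelEach_radius] at hxt hxr hx't hx'r
  rcases side i x hxt hxr with ⟨hyi, hΦi, h4i, h40i, hTi⟩ | ⟨xi, hΨi, htei, hx0i, hr5i⟩ <;>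
    rcases side j x' hx't hx'r with ⟨hyj, hΦj, h4j, h40j, hTj⟩ | ⟨xj, hΨj, htej, hx0j, hr5j⟩
  · -- outer / outer: the same late flat point near two holes
    have hΦΦ : d.flatChart ⟨x.1, hyi⟩ = d.flatChart ⟨x'.1, hyj⟩ := by rw [← hΦi, ← hΦj, heq]
    have hxx' : (x.1 : E4) = x'.1 :=
      hinj ⟨x.1, hyi⟩ ⟨x'.1, hyj⟩ (hT0.trans_le hTi) (hT0.trans_le hTj) hΦΦ
    have h := hsep i j x.1 hij hTi h40i
    rw [hxx'] at h
    exact (lt_irrefl _) (h.trans_le h40j)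
  · -- outer / inner
    have h := hex2 j i hij.symm xj ⟨x.1, hyi⟩ htej hx0j hr5j (hTe.trans hTi) h4i h40i
    exact h (by rw [← hΨj, heq, hΦi])
  · -- inner / outer
    have h := hex2 i j hij xi ⟨x'.1, hyj⟩ htei hx0i hr5i (hTe.trans hTj) h4j h40j
    exact h (by rw [← hΨi, ← heq, hΦj])
  · -- inner / inner
    have h := hex1 i j hij xi xj htei hx0i hr5i htej hx0j hr5j
    exact h (by rw [← hΨi, ← hΨj, heq])

end Summit.FinalStateConjecture.FinalStateConjecture.Theorems.GapDecaySuffices.Bookkeeping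

end
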